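/- Copyright: the b2b-balaban cell (near-miss cell 7), T⁴-continuum fan-out; row NE7b ROUND-2 swarm, seat
t4-ne7b-formalise-leaf-08 (gen 4; row S1c-opt of `t4/b2b-balaban-t4-ne7b-p1/LEAVES-NE7b.md`, owner's rulings
R-OWNER-23-6 (4) and «GO leaf-08: S1c-opt» journal l.13964 — PART 2, the instance for leaf-05 gen 4's value map `valP`).
Released under the licence of the surrounding project. -/
import Summits.QuantumFields.BalabanUV.T4Continuum.Support.HistoryRealiseDistinct
import Summits.QuantumFields.BalabanUV.T4Continuum.Support.HistoryJoinsPlacedValue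

/-!
# Realised histories with distinct, boxed constituents, PART 2: `hdis` for the instance's value map `valP`

Summits-side support leaf of the T⁴-continuum cell (rung (B)+1 on a FINITE torus only; NOT infinite volume, NOT the
mass gap, NOT the Clay statement; NOT a proof of the spine estimate NE7b).  Row NE7b, route «COUNT», optional row
S1c-opt, part 2 (spec of record journal l.13964: «`hdis_of_realisesD` via `valP`-injectivity: equal cell + equal template
inside one box ⇒ equal region»).  [folklore] composition BY NAME of part 1 (`HistoryRealiseDistinct`: the displays
`DisjointJoins`∕`BoxedBirths`∕`RealisesD`, the abstract `hdis_of_realisesD_of_faithful`) with leaf-05 gen 4's value map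
(`HistoryJoinsPlacedValue.valP = (cellV, tmplV)`, `cellV_val`, `translate_tmplV`).  Nothing is quoted from print, nothing
printed is asserted, no `[cite:]` tag, no `Prop` fact, no definition.

WHAT.
* §1 `birth_facts_of_realises`: along `Realises`, every physical birth `((j,0,d′),(anchor, region))` has anchor ∈ region,
  a face-connected region and `treeLen region ≤ d′` (the birth clause; renewals∕joins recurse) — the «good case» of `tmplV`.
* §2 `anchor_eq_of_cellV_eq`: two anchors BOXED at one level (`InBoxAt`, part 1) with the same corner cell `cellV` are
  equal (the reduction `res` inside `cellV` is the identity in the period box).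
* §3 `region_eq_of_valP_eq` — FAITHFULNESS OF `valP` on boxed births of equal label in the good case: equal value ⇒ equal
  anchor (§2) ⇒ equal region (`translate_tmplV`).
* §4 **`hdis_of_realisesD`** — T3b's display `hdis` (R-OWNER-23-6 (1)) DISCHARGED from the strengthened reading:
  `RealisesD L s R n K lv g Z` + per-birth side conditions `lv (step) ≤ K` (levels inside the cutoff) and
  `tcap d (fat) ≤ M` (the template type is large enough — the instance's capacity condition) ⇒
  `((pbirths g).map (fun bz => (bz.1, valP n L K hN lv M hM bz.1 bz.2))).Nodup`; and the display-to-display form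
  `hdis_of_displays_valP` (from `DisjointJoins` + `BoxedBirths` + the birth facts, no `Realises`).

HONEST SCOPE.  `hdis` is discharged ONLY modulo the two DISPLAYED reading clauses of part 1 (`DisjointJoins`,
`BoxedBirths` — print's «components are unions of DISTINCT regions inside the torus», a READING of B16 pp. 384–386) and
the symbolic side conditions named above; nothing of H3∕(B)∕BetaPertH touched; no landed file edited; NE7b NOT proved.
HONEST DEPENDENCY (cell): continuum YM on T⁴ ⇐ BetaPertH ∧ nine spine estimates (0/9 proved); BetaPertH ⇐ (D1) ∧ (D4) ∧
CAP+tail; G-an2-4 gates asym, D1 and NE2/3/4.  This file changes none of it.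
-/

open Finset
open Literature.MathematicalPhysics.QuantumFieldTheory.Balaban1983to89
open Literature.MathematicalPhysics.QuantumFieldTheory.Balaban1983to89.B13ScaleTransfer
open Literature.MathematicalPhysics.QuantumFieldTheory.Balaban1983to89.TreeLength (treeLen)
open T4PersistenceDictionary
open Summit.QuantumFields.BalabanUV.T4Continuum.ZoneTorus
open Summit.QuantumFields.BalabanUV.T4Continuum.HistoryAdmissible
open Summit.QuantumFields.BalabanUV.T4Continuum.HistoryRealise
open Summit.QuantumFields.BalabanUV.T4Continuum.HistoryRegionTemplates
open Summit.QuantumFields.BalabanUV.T4Continuum.HistoryJoinsTemplates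
open Summit.QuantumFields.BalabanUV.T4Continuum.HistoryJoinsPlacedValue

namespace Summit.QuantumFields.BalabanUV.T4Continuum.HistoryRealiseDistinct

noncomputable section

variable {d : ℕ}

/-! ## §1 The birth facts along `Realises` (the good case of `tmplV`) -/

/-- **THE BIRTH FACTS OF A REALISED HISTORY**: every physical birth `((j, 0, d′), (anchor, region))` of a realised history
has its anchor in its region, a face-connected region, and `treeLen region ≤ d′` (the birth clause of `Realises`;
renewals and joins recurse through the partners' realisations). [folklore] -/
theorem birth_facts_of_realises {L : ℕ} {s R : ℕ → ℕ} :
    ∀ (g : PGen (Pt d × Finset (Pt d))) (Z : Finset (Pt d)), Realises L s R g Z →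
      ∀ b ∈ g.pbirths, b.2.1 ∈ b.2.2 ∧ FaceConnected b.2.2 ∧ treeLen b.2.2 ≤ (PEv.fat b.1 : ℝ)
  | .birth j cls zZ, Z, h => by
      intro b hb
      rw [PGen.pbirths_birth, Multiset.mem_singleton] at hb
      subst hb
      obtain ⟨hZ, hz, hc, hl⟩ := h
      refine ⟨?_, ?_, ?_⟩
      · show zZ.1 ∈ zZ.2; rw [hZ]; exact hz
      · show FaceConnected zZ.2; rw [hZ]; exact hc
      · show treeLen zZ.2 ≤ ((PEv.fat ((j, 0, cls) : PEv) : ℕ) : ℝ)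
        rw [hZ]; exact hl
  | .renew G hh, Z, h => by
      obtain ⟨ZG, hG, -⟩ := h
      intro b hb
      rw [PGen.pbirths_renew] at hb
      exact birth_facts_of_realises G ZG hG b hb
  | .join X Y sj, Z, h => by
      obtain ⟨ZX, ZY, hX, hY, -⟩ := h
      intro b hb
      rw [PGen.pbirths_join, Multiset.mem_add] at hb
      rcases hb with hb | hb
      · exact birth_facts_of_realises X ZX hX b hb
      · exact birth_facts_of_realises Y ZY hY b hb

/-! ## §2 Boxed anchors with the same corner cell are equal -/

section Anchor

variable {n L K : ℕ} (hN : 0 < n * L ^ K) {lv : ℕ → ℕ}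

/-- in the period box at level `lv j ≤ K`, the reduction inside `cellV` is the identity: `res (n·L^{K−lv j}) (z i) = z i`
[folklore] -/
theorem res_eq_self_of_inBoxAt {j : ℕ} (hj : lv j ≤ K) {z : Pt d} (hz : InBoxAt n L K lv j z) (i : Fin d) :
    ((res (n * L ^ (K - lv j)) (z i) : ℕ) : ℤ) = z i := by
  obtain ⟨h0, hlt⟩ := hz i
  have hsplit : n * L ^ K = L ^ lv j * (n * L ^ (K - lv j)) := by
    rw [mul_left_comm, ← pow_add, Nat.add_sub_cancel' hj]
  have hlt' : (z i).toNat < n * L ^ (K - lv j) := by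
    rw [hsplit] at hlt
    exact Nat.lt_of_mul_lt_mul_left hlt
  have hz' : z i = ((z i).toNat : ℤ) := (Int.toNat_of_nonneg h0).symm
  rw [hz']
  unfold res
  have hm : (0 : ℤ) ≤ ((z i).toNat : ℤ) := by positivity
  rw [Int.emod_eq_of_lt hm (by exact_mod_cast hlt'), Int.toNat_natCast]

/-- **BOXED ANCHORS AT ONE LEVEL WITH THE SAME CORNER CELL ARE EQUAL** (`cellV` is injective on the period box).
[folklore] -/
theorem anchor_eq_of_cellV_eq (hL : 0 < L) {j : ℕ} (hj : lv j ≤ K) {z z' : Pt d} (hz : InBoxAt n L K lv j z)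
    (hz' : InBoxAt n L K lv j z') (h : cellV n L K hN lv j z = cellV n L K hN lv j z') : z = z' := by
  funext i
  have hv : (cellV n L K hN lv j z i).val = (cellV n L K hN lv j z' i).val := by rw [h]
  rw [cellV_val hN hL hj, cellV_val hN hL hj] at hv
  have hr : res (n * L ^ (K - lv j)) (z i) = res (n * L ^ (K - lv j)) (z' i) :=
    Nat.eq_of_mul_eq_mul_left (pow_pos hL _) hv
  rw [← res_eq_self_of_inBoxAt hj hz i, ← res_eq_self_of_inBoxAt hj hz' i, hr]

end Anchor

/-! ## §3 Faithfulness of `valP` on boxed births of equal label in the good case -/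

section Faithful

variable {n L K : ℕ} (hN : 0 < n * L ^ K) {lv : ℕ → ℕ} {M : ℕ} (hM : 1 ≤ M)

/-- **`valP` IS FAITHFUL**: two physical births with the SAME label, both in the good case of `tmplV` (anchor ∈ region,
face-connected, `treeLen ≤ fat`, `tcap d fat ≤ M`), both BOXED at the level of their step (`≤ K`), and with the same value
`valP` have the same REGION: equal corner cells force equal anchors (§2), and each region is its template translated
back to its anchor (`translate_tmplV`). [folklore] -/
theorem region_eq_of_valP_eq (hL : 0 < L) {b : PEv} (hj : lv b.step ≤ K) {p p' : Pt d × Finset (Pt d)}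
    (hp : p.1 ∈ p.2 ∧ FaceConnected p.2 ∧ treeLen p.2 ≤ (b.fat : ℝ) ∧ tcap d b.fat ≤ M)
    (hp' : p'.1 ∈ p'.2 ∧ FaceConnected p'.2 ∧ treeLen p'.2 ≤ (b.fat : ℝ) ∧ tcap d b.fat ≤ M)
    (hbox : InBoxAt n L K lv b.step p.1) (hbox' : InBoxAt n L K lv b.step p'.1)
    (h : valP n L K hN lv M hM b p = valP n L K hN lv M hM b p') : p.2 = p'.2 := by
  have hc : cellV n L K hN lv b.step p.1 = cellV n L K hN lv b.step p'.1 := congrArg Prod.fst h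
  have ht : tmplV d M hM b.fat p = tmplV d M hM b.fat p' := congrArg Prod.snd h
  have hz : p.1 = p'.1 := anchor_eq_of_cellV_eq hN hL hj hbox hbox' hc
  rw [← translate_tmplV hM hp, ← translate_tmplV hM hp', ht, hz]

end Faithful

/-! ## §4 `hdis` for the instance's value map -/

section Hdis

variable {n L K : ℕ} (hN : 0 < n * L ^ K) {lv : ℕ → ℕ} {M : ℕ} (hM : 1 ≤ M)
  {s R : ℕ → ℕ} {g : PGen (Pt d × Finset (Pt d))} {Z : Finset (Pt d)}

/-- **THE DISPLAY-TO-DISPLAY FORM FOR `valP`**: `DisjointJoins` + `BoxedBirths` + the three birth facts + the per-birth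
side conditions `lv (step) ≤ K`, `tcap d (fat) ≤ M` (`0 < L`) ⇒ the birth-value multiset is duplicate-free. [folklore] -/
theorem hdis_of_displays_valP (hL : 0 < L) (hd : DisjointJoins g) (hB : BoxedBirths n L K lv g)
    (hfacts : ∀ b ∈ g.pbirths, b.2.1 ∈ b.2.2 ∧ FaceConnected b.2.2 ∧ treeLen b.2.2 ≤ (PEv.fat b.1 : ℝ))
    (hK : ∀ b ∈ g.pbirths, lv (PEv.step b.1) ≤ K) (hcap : ∀ b ∈ g.pbirths, tcap d (PEv.fat b.1) ≤ M) :
    (g.pbirths.map (fun bz => (bz.1, valP n L K hN lv M hM bz.1 bz.2))).Nodup :=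
  hdis_of_displays (valP n L K hN lv M hM) hd hB (fun b hb => (hfacts b hb).1)
    (fun b hb b' hb' hl hbox hbox' _ _ hv => by
      have hp := hfacts b hb
      have hp' := hfacts b' hb'
      rw [← hl] at hp' hbox' hv
      exact region_eq_of_valP_eq hN hM hL (hK b hb) ⟨hp.1, hp.2.1, hp.2.2, hcap b hb⟩
        ⟨hp'.1, hp'.2.1, hp'.2.2, hcap b hb⟩ (hbox _ hp.1) (hbox' _ hp'.1) hv)

/-- **ROW S1c-opt — T3b's `hdis` DISCHARGED FROM THE STRENGTHENED READING.**  For a history realised with DISTINCT,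
BOXED constituents (`RealisesD`, part 1), with every birth level inside the cutoff (`lv (step) ≤ K`) and the template
type large enough (`tcap d (fat) ≤ M`), the birth-VALUE multiset
`(pbirths g).map (label, valP label payload)` is duplicate-free — the display `hdis` of R-OWNER-23-6 (1), in the letters
of the key of record. [folklore] -/
theorem hdis_of_realisesD (hL : 0 < L) (h : RealisesD L s R n K lv g Z)
    (hK : ∀ b ∈ g.pbirths, lv (PEv.step b.1) ≤ K) (hcap : ∀ b ∈ g.pbirths, tcap d (PEv.fat b.1) ≤ M) :
    (g.pbirths.map (fun bz => (bz.1, valP n L K hN lv M hM bz.1 bz.2))).Nodup :=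
  hdis_of_displays_valP hN hM hL h.2.1 h.2.2 (birth_facts_of_realises g Z h.1) hK hcap

end Hdis

end

end Summit.QuantumFields.BalabanUV.T4Continuum.HistoryRealiseDistinct
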